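import Literature.NumberTheory.EllipticCurves.KubertTate1314Kummer
import Literature.NumberTheory.EllipticCurves.KubertTateFiveKummerPadicVal
import Literature.NumberTheory.EllipticCurves.X1ElevenKummerValues
import HarnessLib

/-!
# The Kubert–Tate curve `E_{13/14}`: Kummer classes of rational points lie in `⟨2, 7, 13⟩ ⊗ 𝔽₅`
# and are cancelled by `2T, P₁, P₂` (towards `rank E_{13/14}(ℚ) ≤ 2`)

PROOF-ONLY file (theorems only), topic `NumberTheory/EllipticCurves`; sequel of
`KubertTate1314Kummer`. For `E = E_{13/14} = kubertTateFive 13 14` (`T = (0,0)`, `T₂ = 2T = (182, 2366)`,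
`P₁ = (-78, 936)`, `P₂ = (98, 392)`) and `f_T = xy - 14x² + 196y`:
* `five_nsmul_T₂`, `exists_T_eq_nsmul_T₂` — `T₂ ∈ ker φ` (five-candidate count), `5T₂ = O`, `T ∈ ⟨T₂⟩`;
* `five_dvd_padicValRat_f` — `5 ∣ ord_p f_T(P)` for rational `P ≠ T` and `p ∉ {2, 7, 13}`;
* `exists_f_five_nsmul_P₁_eq_pow` — `f_T(5P₁) ∈ (ℚˣ)⁵` (relation `T₂ + 3T = O`, `f_T(2T)f_T(3T) = -182⁵`);
* `exists_translate_f_eq_pow` — for rational `P ∉ {O, T}` there are `i, j, k < 5` (inverse matrix mod `5`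
  of the images `(2,2,3)`, `(3,0,1)`, `(3,4,0)` of `T₂, P₁, P₂`) with `f_T(P + iT₂ + jP₁ + kP₂) ∈ (ℚˣ)⁵`
  whenever that translate is affine `≠ T` (five-point relation `exists_pow_five_mul_eq₅`, unique
  factorisation). The sequel `KubertTate1314RankLe` concludes `rank ≤ 2`.

## References

* [SilvermanAEC2009] J. H. Silverman, *AEC*, 2nd ed., Thm. X.1.1 and its proof, Exercise 10.1, X.4.
* [Kubert1976] D. S. Kubert, *Universal bounds on the torsion of elliptic curves*, Table 3.
-/

noncomputable section

open scoped Classical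
open WeierstrassCurve Field
open Literature.NumberTheory.EllipticCurves Literature.NumberTheory.EllipticCurves.KubertTateKummer
  Literature.NumberTheory.EllipticCurves.KubertTateVelu

-- The `ℚ`-algebra diamond on `AlgebraicClosure ℚ`: same device as `KubertTate1314Torsion`.
attribute [-instance] DivisionRing.toRatAlgebra

namespace Literature.NumberTheory.EllipticCurves

namespace KubertTate1314Descent

/-- Two affine points with equal coordinates are equal (proof-irrelevant form). [folklore] -/
private theorem some_eq_some_of_eq' {R : Type*} [CommRing R] {V : WeierstrassCurve R}
    {x y x' y' : R} (hx : x = x') (hy : y = y') (h : V.toAffine.Nonsingular x y)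
    (h' : V.toAffine.Nonsingular x' y') : Affine.Point.some x y h = Affine.Point.some x' y' h' := by
  subst hx hy; rfl

/-- `f_T(x, y) = xy - 14x² + 196y` at a rational point, as a value of the tree's `kummerFn 13 14`
(local copy of `KubertTate1314Rank.hasValueAt_point`). [cite: SilvermanAEC2009, Exercise 10.1(c)] -/
private theorem hasValueAt_point' {x y : ℚ} (h : E.toAffine.Nonsingular x y) :
    E.HasValueAt (kummerFn (13 : ℚ) 14) (toGeom (.some x y h))
      (algebraMap ℚ (AlgebraicClosure ℚ) (x * y - 14 * x ^ 2 + 14 ^ 2 * y)) := by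
  obtain ⟨h', e⟩ := toGeom_some h
  rw [e]
  refine (hasValueAt_kummerFn (13 : ℚ) 14 h').congr rfl ?_
  simp only [map_sub, map_add, map_mul, map_pow]

/-! ### `T₂ = (182, 2366)` lies in `ker φ`: `5T₂ = O`, `T ∈ ⟨T₂⟩` -/

/-- `toGeom T₂ ∈ ker φ`: the kernel has `5` elements inside `{O, T̄, (0,mn²), (mn,0), (mn,m²n)}`
(`mem_ker_fiveIsogeny_imp`, `natCard_ker_fiveIsogeny`), and `toGeom T₂ = (mn, m²n)` is one of the
five candidates. [cite: SilvermanAEC2009, Thm. III.4.10(c)] -/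
theorem toGeom_T₂_mem_ker : toGeom T₂ ∈ (fiveIsogeny (13 : ℚ) 14).toAddMonoidHom.ker := by
  set ι := algebraMap ℚ (AlgebraicClosure ℚ) with hι
  obtain ⟨h01, h10, h11⟩ := nonsingular_candidates (13 : ℚ) 14
  have hT₂ns : E.toAffine.Nonsingular 182 2366 := (nonsingular_iff _ _).mpr (by norm_num)
  obtain ⟨h', e⟩ := toGeom_some hT₂ns
  have eT₂ : toGeom T₂ = Affine.Point.some _ _ h11 := by
    rw [show T₂ = Affine.Point.some 182 2366 hT₂ns from rfl, e]
    exact some_eq_some_of_eq' (by norm_num) (by norm_num) _ _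
  by_contra hmem
  -- `ker φ ⊆ {O, T̄, P01, P10, P11} ∖ {P11}`
  let P01 : geomPoints E := Affine.Point.some _ _ h01
  let P10 : geomPoints E := Affine.Point.some _ _ h10
  let F : Finset (geomPoints E) := {0, Tbar (13 : ℚ) 14, P01, P10, toGeom T₂}
  have hF5 : F.card ≤ 5 :=
    (Finset.card_insert_le _ _).trans (Nat.succ_le_succ ((Finset.card_insert_le _ _).trans
      (Nat.succ_le_succ ((Finset.card_insert_le _ _).trans (Nat.succ_le_succ
        ((Finset.card_insert_le _ _).trans (Nat.succ_le_succ (Finset.card_singleton _).le)))))))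
  have hTF : toGeom T₂ ∈ F := by simp [F]
  have hsub : ((fiveIsogeny (13 : ℚ) 14).toAddMonoidHom.ker : Set (geomPoints E)) ⊆ ↑(F.erase (toGeom T₂)) := by
    intro P hP
    have hP0 : fiveIsogeny (13 : ℚ) 14 P = 0 := hP
    rw [Finset.coe_erase]
    refine ⟨?_, fun h ↦ hmem (h ▸ hP)⟩
    simp only [F, Finset.coe_insert, Finset.coe_singleton, Set.mem_insert_iff, Set.mem_singleton_iff]
    rcases mem_ker_fiveIsogeny_imp (13 : ℚ) 14 hP0 with rfl | ⟨x, y, h, rfl, ⟨hx, hy | hy⟩ | ⟨hx, hy | hy⟩⟩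
    · exact Or.inl rfl
    · subst hx; subst hy; exact Or.inr (Or.inl rfl)
    · subst hx; subst hy; exact Or.inr (Or.inr (Or.inl rfl))
    · subst hx; subst hy; exact Or.inr (Or.inr (Or.inr (Or.inl rfl)))
    · subst hx; subst hy; right; right; right; right; exact eT₂.symm
  have h1 : ((fiveIsogeny (13 : ℚ) 14).toAddMonoidHom.ker : Set (geomPoints E)).ncard ≤ 4 := by
    calc ((fiveIsogeny (13 : ℚ) 14).toAddMonoidHom.ker : Set (geomPoints E)).ncard
        ≤ (↑(F.erase (toGeom T₂)) : Set _).ncard := Set.ncard_le_ncard hsub (Finset.finite_toSet _)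
      _ = (F.erase (toGeom T₂)).card := Set.ncard_coe_finset _
      _ ≤ 4 := by rw [Finset.card_erase_of_mem hTF]; omega
  have h2 := natCard_ker_fiveIsogeny (13 : ℚ) 14
  rw [← SetLike.coe_sort_coe, Nat.card_coe_set_eq] at h2
  omega

/-- **`5T₂ = O`** in `E(ℚ)`. [cite: Kubert1976, Table 3 (N = 5)] -/
theorem five_nsmul_T₂ : (5 : ℕ) • T₂ = 0 := by
  apply toGeom_injective
  rw [map_nsmul, map_zero]
  exact five_nsmul_eq_zero_of_mem_ker (13 : ℚ) 14 toGeom_T₂_mem_ker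

/-- **`T ∈ ⟨T₂⟩`**: `T = k T₂` for some `k < 5` (both generate the rational `5`-torsion `⟨T⟩`).
[cite: Kubert1976, Table 3 (N = 5)] -/
theorem exists_T_eq_nsmul_T₂ : ∃ k : ℕ, k < 5 ∧ T = k • T₂ := by
  have hT₂0 : T₂ ≠ 0 := Affine.Point.some_ne_zero _
  -- `T₂ ∈ E(ℚ)[25] = ⟨T⟩`
  have hmem : T₂ ∈ AddSubgroup.zmultiples T := by
    rw [← torsionBy_twentyfive_eq]
    apply AddSubgroup.torsionBy.nsmul_iff.mpr
    rw [show (25 : ℕ) = 5 * 5 from rfl, mul_nsmul, five_nsmul_T₂, nsmul_zero]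
  have hle : AddSubgroup.zmultiples T₂ ≤ AddSubgroup.zmultiples T := AddSubgroup.zmultiples_le.mpr hmem
  have hord : addOrderOf T₂ = 5 := by
    rcases (Nat.dvd_prime Nat.prime_five).mp (addOrderOf_dvd_of_nsmul_eq_zero five_nsmul_T₂) with h1 | h5
    · exact absurd (AddMonoid.addOrderOf_eq_one_iff.mp h1) hT₂0
    · exact h5
  haveI : Finite (AddSubgroup.zmultiples T) := by
    apply Nat.finite_of_card_ne_zero; rw [Nat.card_zmultiples, addOrderOf_T]; norm_num
  have heq : AddSubgroup.zmultiples T₂ = AddSubgroup.zmultiples T :=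
    AddSubgroup.eq_of_le_of_card_ge hle (by rw [Nat.card_zmultiples, Nat.card_zmultiples, addOrderOf_T, hord])
  have hT : T ∈ AddSubgroup.zmultiples T₂ := by rw [heq]; exact AddSubgroup.mem_zmultiples T
  obtain ⟨k, hk⟩ := AddSubgroup.mem_zmultiples_iff.mp hT
  refine ⟨(k % 5).toNat, by omega, ?_⟩
  have h5z : (5 : ℤ) • T₂ = 0 := by
    rw [show (5 : ℤ) = ((5 : ℕ) : ℤ) from rfl, natCast_zsmul, five_nsmul_T₂]
  have hk' : k • T₂ = (k % 5) • T₂ := by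
    conv_lhs => rw [← Int.emod_add_mul_ediv k 5]
    rw [add_zsmul, mul_zsmul', h5z, zsmul_zero, add_zero]
  rw [← natCast_zsmul, Int.toNat_of_nonneg (Int.emod_nonneg k (by norm_num)), ← hk', hk]

/-! ### Valuations of `f_T` at rational points away from `2, 7, 13` -/

/-- `ord_p 13 = ord_p 14 = 0` for a prime `p ∉ {2, 7, 13}`. [folklore] -/
private theorem padicValRat_thirteen_fourteen {p : ℕ} [hp : Fact p.Prime] (h2 : p ≠ 2) (h7 : p ≠ 7)
    (h13 : p ≠ 13) : padicValRat p (13 : ℚ) = 0 ∧ padicValRat p (14 : ℚ) = 0 := by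
  have h13' : ¬ p ∣ 13 := fun h ↦ h13 ((Nat.prime_dvd_prime_iff_eq hp.out (by norm_num)).mp h)
  have h14' : ¬ p ∣ 14 := by
    intro h
    rcases (Nat.Prime.dvd_mul hp.out).mp (show p ∣ 2 * 7 from h) with h | h
    · exact h2 ((Nat.prime_dvd_prime_iff_eq hp.out Nat.prime_two).mp h)
    · exact h7 ((Nat.prime_dvd_prime_iff_eq hp.out (by norm_num)).mp h)
  constructor
  · rw [show (13 : ℚ) = ((13 : ℕ) : ℚ) by norm_num, padicValRat.of_nat,
      padicValNat.eq_zero_of_not_dvd h13', Nat.cast_zero]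
  · rw [show (14 : ℚ) = ((14 : ℕ) : ℚ) by norm_num, padicValRat.of_nat,
      padicValNat.eq_zero_of_not_dvd h14', Nat.cast_zero]

/-- `f_T(x, y) ≠ 0` at a rational point `(x, y) ≠ T` (`f_T · f_{-T} = -x⁵`). [cite: SilvermanAEC2009, Exercise 10.1(c)] -/
theorem f_ne_zero {x y : ℚ} (h : E.toAffine.Nonsingular x y) (hT : ¬ (x = 0 ∧ y = 0)) :
    x * y - 14 * x ^ 2 + 14 ^ 2 * y ≠ 0 := by
  have he : y ^ 2 + (14 - 13) * x * y - 13 * 14 ^ 2 * y = x ^ 3 - 13 * 14 * x ^ 2 := by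
    have := (nonsingular_iff x y).mp h; linear_combination this
  intro h0
  have hprod := kummerFn_mul_kummerFn_neg he
  rw [h0, zero_mul] at hprod
  have hx : x = 0 := pow_eq_zero_iff (n := 5) (by norm_num) |>.mp (neg_eq_zero.mp hprod.symm)
  apply hT
  refine ⟨hx, ?_⟩
  rw [hx] at h0
  linarith

/-- **`5 ∣ ord_p f_T(P)` for `p ∉ {2, 7, 13}`** at every rational point `P = (x, y) ≠ T` of `E_{13/14}`
(the `μ₅`-Kummer class of a rational point is unramified away from `2·7·13`, including at `5` and at
`2029`). [cite: SilvermanAEC2009, Thm. X.1.1(c) (proof)] -/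
theorem five_dvd_padicValRat_f {x y : ℚ} (h : E.toAffine.Nonsingular x y) (hT : ¬ (x = 0 ∧ y = 0))
    {p : ℕ} [Fact p.Prime] (h2 : p ≠ 2) (h7 : p ≠ 7) (h13 : p ≠ 13) :
    (5 : ℤ) ∣ padicValRat p (x * y - 14 * x ^ 2 + 14 ^ 2 * y) := by
  obtain ⟨h13v, h14v⟩ := padicValRat_thirteen_fourteen h2 h7 h13
  have he : y ^ 2 + (14 - 13) * x * y - 13 * 14 ^ 2 * y = x ^ 3 - 13 * 14 * x ^ 2 := by
    have := (nonsingular_iff x y).mp h; linear_combination this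
  exact five_dvd_padicValRat_kummerFn p (by norm_num) h13v (by norm_num) h14v he hT

/-! ### `f_T(5P₁)` is a fifth power -/

/-- **`f_T(5P₁) ∈ (ℚˣ)⁵`**: `5P₁ = (x₅, y₅)` is an affine point `≠ T` and `f_T(x₅, y₅) = t₀⁵`,
`t₀ ∈ ℚˣ`. (From the relation `T₂ + 3T = O`: `u⁵ · f_T(5P₁)² = f_T(2T) f_T(3T) = -182⁵`, so every
`ord_p f_T(5P₁)` is divisible by `5`, and unique factorisation.) [cite: SilvermanAEC2009, Thm. X.1.1(c) (proof)] -/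
theorem exists_f_five_nsmul_P₁_eq_pow : ∃ (x₅ y₅ : ℚ) (h₅ : E.toAffine.Nonsingular x₅ y₅) (t₀ : ℚ),
    (5 : ℕ) • P₁ = .some x₅ y₅ h₅ ∧ t₀ ≠ 0 ∧ x₅ * y₅ - 14 * x₅ ^ 2 + 14 ^ 2 * y₅ = t₀ ^ 5 := by
  set ι := algebraMap ℚ (AlgebraicClosure ℚ) with hι
  have hnsT₂ : E.toAffine.Nonsingular 182 2366 := (nonsingular_iff _ _).mpr (by norm_num)
  have hnsT₃ : E.toAffine.Nonsingular 182 0 := (nonsingular_iff _ _).mpr (by norm_num)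
  have hnsP₁ : E.toAffine.Nonsingular (-78) 936 := (nonsingular_iff _ _).mpr (by norm_num)
  obtain ⟨hT₂0, hT₂T⟩ : T₂ ≠ 0 ∧ T₂ ≠ T :=
    ⟨Affine.Point.some_ne_zero _, fun e ↦ by injection e with hx; norm_num at hx⟩
  obtain ⟨hT₃0, hT₃T⟩ : (Affine.Point.some 182 0 hnsT₃ : E.toAffine.Point) ≠ 0 ∧
      Affine.Point.some 182 0 hnsT₃ ≠ T :=
    ⟨Affine.Point.some_ne_zero _, fun e ↦ by injection e with hx; norm_num at hx⟩
  obtain ⟨hP₁0, hP₁T⟩ : P₁ ≠ 0 ∧ P₁ ≠ T :=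
    ⟨Affine.Point.some_ne_zero _, fun e ↦ by injection e with hx; norm_num at hx⟩
  have hfT₂ : E.HasValueAt (kummerFn (13 : ℚ) 14) (toGeom T₂) (ι 430612) :=
    (hasValueAt_point' hnsT₂).congr rfl (by norm_num)
  have hfT₃ : E.HasValueAt (kummerFn (13 : ℚ) 14) (toGeom (.some 182 0 hnsT₃)) (ι (-463736)) :=
    (hasValueAt_point' hnsT₃).congr rfl (by norm_num)
  have hfP₁ : E.HasValueAt (kummerFn (13 : ℚ) 14) (toGeom P₁) (ι 25272) :=
    (hasValueAt_point' hnsP₁).congr rfl (by norm_num)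
  obtain ⟨h50, h5T⟩ := five_nsmul_ne (h := hnsP₁) (by norm_num : (-78 : ℚ) ≠ 0) (by norm_num)
  obtain ⟨x₅, y₅, h₅, e₅⟩ : ∃ (x y : ℚ) (h : E.toAffine.Nonsingular x y),
      (5 : ℕ) • P₁ = Affine.Point.some x y h := by
    rcases h5 : (5 : ℕ) • P₁ with _ | ⟨x, y, h⟩
    · exact absurd h5 h50
    · exact ⟨x, y, h, rfl⟩
  set α₀ : ℚ := x₅ * y₅ - 14 * x₅ ^ 2 + 14 ^ 2 * y₅ with hα₀
  have ha₀ : E.HasValueAt (kummerFn (13 : ℚ) 14) (((5 : ℕ) : ℤ) • toGeom P₁) (ι α₀) := by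
    rw [natCast_zsmul, ← map_nsmul, e₅]
    exact hasValueAt_point' h₅
  have hrel : 1 • T₂ + 1 • Affine.Point.some 182 0 hnsT₃ + 0 • P₁ = (5 : ℕ) • (0 : E.toAffine.Point) := by
    rw [one_nsmul, one_nsmul, zero_nsmul, add_zero, nsmul_zero, ← neg_T₂, add_neg_cancel]
  obtain ⟨u₁, hu₁0, hu₁⟩ := exists_pow_five_mul_eq hT₂0 hT₂T hT₃0 hT₃T hP₁0 hP₁T hfT₂ hfT₃ hfP₁
    h50 h5T ha₀ 1 1 0 hrel
  -- in `ℚ`: `u₁⁵ α₀² = -182⁵`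
  have hQ : u₁ ^ 5 * α₀ ^ 2 = -182 ^ 5 := by
    apply ι.injective
    rw [map_mul, map_pow, map_pow, hu₁]
    norm_num
  have hα₀0 : α₀ ≠ 0 := by
    intro h0; rw [h0] at hQ; norm_num at hQ
  have hdiv : ∀ p : ℕ, p.Prime → (5 : ℤ) ∣ padicValRat p α₀ := by
    intro p hp
    haveI : Fact p.Prime := ⟨hp⟩
    have e := congrArg (padicValRat p) hQ
    rw [padicValRat.mul (pow_ne_zero _ hu₁0) (pow_ne_zero _ hα₀0), padicValRat.pow u₁,
      padicValRat.pow α₀, padicValRat.neg, padicValRat.pow (182 : ℚ)] at e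
    push_cast at e
    have h5 : (5 : ℤ) ∣ 2 * padicValRat p α₀ := ⟨padicValRat p 182 - padicValRat p u₁, by linarith⟩
    omega
  obtain ⟨t₀, ht₀0, ht₀⟩ := X1Eleven.exists_eq_pow_of_forall_dvd_padicValRat hα₀0 (by decide) hdiv
  exact ⟨x₅, y₅, h₅, t₀, e₅, ht₀0, ht₀⟩

/-- `v_p(n) = k` from a factorisation `n = p^k · r`, `p ∤ r`. [folklore] -/
private theorem padicValRat_natCast_eq' {p n k r : ℕ} [hp : Fact p.Prime] (h : n = p ^ k * r)
    (hr : ¬ p ∣ r) : padicValRat p (n : ℚ) = k := by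
  have hr0 : r ≠ 0 := fun h0 ↦ hr (h0 ▸ dvd_zero p)
  rw [padicValRat.of_nat, h, padicValNat.mul (pow_ne_zero _ hp.out.ne_zero) hr0, padicValNat.prime_pow,
    padicValNat.eq_zero_of_not_dvd hr, add_zero]

/-- The `2`-, `7`-, `13`-adic valuations of `f_T(2T) = 430612 = 2²7²13³`, `f_T(P₁) = 25272 = 2³3⁵13`,
`f_T(P₂) = -19208 = -2³7⁴` (arithmetic). [folklore] -/
private theorem vals' :
    (padicValRat 2 (430612 : ℚ) = 2 ∧ padicValRat 2 (25272 : ℚ) = 3 ∧ padicValRat 2 (-19208 : ℚ) = 3) ∧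
    (padicValRat 7 (430612 : ℚ) = 2 ∧ padicValRat 7 (25272 : ℚ) = 0 ∧ padicValRat 7 (-19208 : ℚ) = 4) ∧
    (padicValRat 13 (430612 : ℚ) = 3 ∧ padicValRat 13 (25272 : ℚ) = 1 ∧
      padicValRat 13 (-19208 : ℚ) = 0) := by
  haveI : Fact (Nat.Prime 2) := ⟨Nat.prime_two⟩
  haveI : Fact (Nat.Prime 7) := ⟨by norm_num⟩
  haveI : Fact (Nat.Prime 13) := ⟨by norm_num⟩
  refine ⟨⟨?_, ?_, ?_⟩, ⟨?_, ?_, ?_⟩, ⟨?_, ?_, ?_⟩⟩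
  · exact_mod_cast padicValRat_natCast_eq' (p := 2) (n := 430612) (k := 2) (r := 107653) (by norm_num) (by norm_num)
  · exact_mod_cast padicValRat_natCast_eq' (p := 2) (n := 25272) (k := 3) (r := 3159) (by norm_num) (by norm_num)
  · rw [padicValRat.neg]
    exact_mod_cast padicValRat_natCast_eq' (p := 2) (n := 19208) (k := 3) (r := 2401) (by norm_num) (by norm_num)
  · exact_mod_cast padicValRat_natCast_eq' (p := 7) (n := 430612) (k := 2) (r := 8788) (by norm_num) (by norm_num)
  · exact_mod_cast padicValRat_natCast_eq' (p := 7) (n := 25272) (k := 0) (r := 25272) (by norm_num) (by norm_num)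
  · rw [padicValRat.neg]
    exact_mod_cast padicValRat_natCast_eq' (p := 7) (n := 19208) (k := 4) (r := 8) (by norm_num) (by norm_num)
  · exact_mod_cast padicValRat_natCast_eq' (p := 13) (n := 430612) (k := 3) (r := 196) (by norm_num) (by norm_num)
  · exact_mod_cast padicValRat_natCast_eq' (p := 13) (n := 25272) (k := 1) (r := 1944) (by norm_num) (by norm_num)
  · rw [padicValRat.neg]
    exact_mod_cast padicValRat_natCast_eq' (p := 13) (n := 19208) (k := 0) (r := 19208) (by norm_num) (by norm_num)

/-! ### Cancelling the class of `f_T(P)` in `⟨2, 7, 13⟩ ⊗ 𝔽₅` by `T₂, P₁, P₂` -/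

/-- The multiplicative relation for a translate: if `P + iT₂ + jP₁ + kP₂ = P''` with `P, P''` affine
and `≠ T`, then `u⁵ t₀^{5(i+j+k+5)} = f_T(P) · f_T(T₂)^i f_T(P₁)^j f_T(P₂)^k · f_T(P'')⁴` for some
`u, t₀ ∈ ℚˣ` (`exists_pow_five_mul_eq₅` on `P + iT₂ + jP₁ + kP₂ + 4P'' = 5P''`, with `f_T(5P₁) = t₀⁵`).
[cite: SilvermanAEC2009, Thm. X.1.1 (proof) and Exercise 10.1] -/
theorem exists_rel_translate {x y x'' y'' : ℚ} (h : E.toAffine.Nonsingular x y) (hT : ¬ (x = 0 ∧ y = 0))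
    (h'' : E.toAffine.Nonsingular x'' y'') (hT'' : ¬ (x'' = 0 ∧ y'' = 0)) {i j k : ℕ}
    (e : Affine.Point.some x y h + i • T₂ + j • P₁ + k • P₂ = .some x'' y'' h'') :
    ∃ u t₀ : ℚ, u ≠ 0 ∧ t₀ ≠ 0 ∧ u ^ 5 * (t₀ ^ 5) ^ (1 + i + j + k + 4) =
      (x * y - 14 * x ^ 2 + 14 ^ 2 * y) ^ 1 * 430612 ^ i * 25272 ^ j * (-19208) ^ k *
        (x'' * y'' - 14 * x'' ^ 2 + 14 ^ 2 * y'') ^ 4 := by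
  set ι := algebraMap ℚ (AlgebraicClosure ℚ) with hι
  have hnsT₂ : E.toAffine.Nonsingular 182 2366 := (nonsingular_iff _ _).mpr (by norm_num)
  have hnsP₁ : E.toAffine.Nonsingular (-78) 936 := (nonsingular_iff _ _).mpr (by norm_num)
  have hnsP₂ : E.toAffine.Nonsingular 98 392 := (nonsingular_iff _ _).mpr (by norm_num)
  obtain ⟨hT₂0, hT₂T⟩ : T₂ ≠ 0 ∧ T₂ ≠ T :=
    ⟨Affine.Point.some_ne_zero _, fun e ↦ by injection e with hx; norm_num at hx⟩
  obtain ⟨hP₁0, hP₁T⟩ : P₁ ≠ 0 ∧ P₁ ≠ T :=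
    ⟨Affine.Point.some_ne_zero _, fun e ↦ by injection e with hx; norm_num at hx⟩
  obtain ⟨hP₂0, hP₂T⟩ : P₂ ≠ 0 ∧ P₂ ≠ T :=
    ⟨Affine.Point.some_ne_zero _, fun e ↦ by injection e with hx; norm_num at hx⟩
  have hP0 : (Affine.Point.some x y h : E.toAffine.Point) ≠ 0 := Affine.Point.some_ne_zero _
  have hPT : Affine.Point.some x y h ≠ T := fun e ↦ hT (by
    have := Affine.Point.some.inj e; exact ⟨this.1, this.2⟩)
  have hP''0 : (Affine.Point.some x'' y'' h'' : E.toAffine.Point) ≠ 0 := Affine.Point.some_ne_zero _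
  have hP''T : Affine.Point.some x'' y'' h'' ≠ T := fun e ↦ hT'' (by
    have := Affine.Point.some.inj e; exact ⟨this.1, this.2⟩)
  have hfP := hasValueAt_point' h
  have hfT₂ : E.HasValueAt (kummerFn (13 : ℚ) 14) (toGeom T₂) (ι 430612) :=
    (hasValueAt_point' hnsT₂).congr rfl (by norm_num)
  have hfP₁ : E.HasValueAt (kummerFn (13 : ℚ) 14) (toGeom P₁) (ι 25272) :=
    (hasValueAt_point' hnsP₁).congr rfl (by norm_num)
  have hfP₂ : E.HasValueAt (kummerFn (13 : ℚ) 14) (toGeom P₂) (ι (-19208)) :=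
    (hasValueAt_point' hnsP₂).congr rfl (by norm_num)
  have hfP'' := hasValueAt_point' h''
  -- the base point and `a₀ = t₀⁵`
  obtain ⟨x₅, y₅, h₅, t₀, e₅, ht₀0, hα₀⟩ := exists_f_five_nsmul_P₁_eq_pow
  obtain ⟨h50, h5T⟩ := five_nsmul_ne (h := hnsP₁) (by norm_num : (-78 : ℚ) ≠ 0) (by norm_num)
  have ha₀ : E.HasValueAt (kummerFn (13 : ℚ) 14) (((5 : ℕ) : ℤ) • toGeom P₁) (ι (t₀ ^ 5)) := by
    rw [natCast_zsmul, ← map_nsmul, e₅, ← hα₀]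
    exact hasValueAt_point' h₅
  -- the five-point relation `P + iT₂ + jP₁ + kP₂ + 4P'' = 5P''`
  have hrel : 1 • Affine.Point.some x y h + i • T₂ + j • P₁ + k • P₂ + 4 • Affine.Point.some x'' y'' h'' =
      (5 : ℕ) • Affine.Point.some x'' y'' h'' := by
    rw [one_nsmul, e]; exact (succ_nsmul' _ 4).symm
  obtain ⟨u, hu0, hu⟩ := exists_pow_five_mul_eq₅ hP0 hPT hT₂0 hT₂T hP₁0 hP₁T hP₂0 hP₂T hP''0 hP''T
    hfP hfT₂ hfP₁ hfP₂ hfP'' h50 h5T ha₀ 1 i j k 4 hrel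
  refine ⟨u, t₀, hu0, ht₀0, ι.injective ?_⟩
  rw [map_mul, map_pow, map_pow, hu]

/-- Valuation form of `exists_rel_translate`: for every prime `p`,
`5 ∣ ord_p f + i·ord_p f(T₂) + j·ord_p f(P₁) + k·ord_p f(P₂) + 4·ord_p f''`. [folklore] -/
private theorem five_dvd_of_rel_translate {p : ℕ} [Fact p.Prime] {f f'' u t₀ : ℚ} (hf0 : f ≠ 0)
    (hf''0 : f'' ≠ 0) (hu0 : u ≠ 0) (ht₀0 : t₀ ≠ 0) {i j k : ℕ}
    (hQ : u ^ 5 * (t₀ ^ 5) ^ (1 + i + j + k + 4) =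
      f ^ 1 * 430612 ^ i * 25272 ^ j * (-19208) ^ k * f'' ^ 4) :
    (5 : ℤ) ∣ padicValRat p f + i * padicValRat p 430612 + j * padicValRat p 25272 +
      k * padicValRat p (-19208) + 4 * padicValRat p f'' := by
  have e := congrArg (padicValRat p) hQ
  rw [padicValRat.mul (pow_ne_zero _ hu0) (pow_ne_zero _ (pow_ne_zero _ ht₀0)), padicValRat.pow u,
    padicValRat.pow (t₀ ^ 5), padicValRat.pow t₀,
    padicValRat.mul (mul_ne_zero (mul_ne_zero (mul_ne_zero (pow_ne_zero _ hf0) (pow_ne_zero _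
      (by norm_num))) (pow_ne_zero _ (by norm_num))) (pow_ne_zero _ (by norm_num))) (pow_ne_zero _ hf''0),
    padicValRat.mul (mul_ne_zero (mul_ne_zero (pow_ne_zero _ hf0) (pow_ne_zero _ (by norm_num)))
      (pow_ne_zero _ (by norm_num))) (pow_ne_zero _ (by norm_num)),
    padicValRat.mul (mul_ne_zero (pow_ne_zero _ hf0) (pow_ne_zero _ (by norm_num)))
      (pow_ne_zero _ (by norm_num)),
    padicValRat.mul (pow_ne_zero _ hf0) (pow_ne_zero _ (by norm_num)),
    padicValRat.pow f, padicValRat.pow (430612 : ℚ), padicValRat.pow (25272 : ℚ),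
    padicValRat.pow (-19208 : ℚ), padicValRat.pow f''] at e
  push_cast at e
  exact ⟨padicValRat p u + (1 + i + j + k + 4 : ℕ) * padicValRat p t₀, by push_cast; linarith⟩

/-- The linear algebra mod `5`: with `(i, j, k) ≡ -(t₂, t₇, t₁₃) M⁻¹`, the three congruences force
`5 ∣ v₂, v₇, v₁₃`. [folklore] -/
private theorem solve_mod_five {t₂ t₇ t₁₃ v₂ v₇ v₁₃ : ℤ} {i j k : ℕ}
    (hi : (5 : ℤ) ∣ (i : ℤ) - (t₂ + 3 * t₇ + 2 * t₁₃)) (hj : (5 : ℤ) ∣ (j : ℤ) - (2 * t₂ + t₇ + 3 * t₁₃))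
    (hk : (5 : ℤ) ∣ (k : ℤ) - (2 * t₂ + 2 * t₇ + 4 * t₁₃))
    (h2 : (5 : ℤ) ∣ t₂ + i * 2 + j * 3 + k * 3 + 4 * v₂)
    (h7 : (5 : ℤ) ∣ t₇ + i * 2 + j * 0 + k * 4 + 4 * v₇)
    (h13 : (5 : ℤ) ∣ t₁₃ + i * 3 + j * 1 + k * 0 + 4 * v₁₃) :
    (5 : ℤ) ∣ v₂ ∧ (5 : ℤ) ∣ v₇ ∧ (5 : ℤ) ∣ v₁₃ := by
  omega

/-- **The translate with fifth-power Kummer value**: for rational `P = (x, y) ∉ {O, T}` there are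
`i, j, k < 5` (`≡ -(v₂, v₇, v₁₃)(f_T(P)) · M⁻¹ mod 5`) such that `f_T(P + iT₂ + jP₁ + kP₂)` is a fifth
power in `ℚˣ` whenever that translate is affine `≠ T`. [cite: SilvermanAEC2009, Thm. X.1.1 (proof) and Exercise 10.1] -/
theorem exists_translate_f_eq_pow {x y : ℚ} (h : E.toAffine.Nonsingular x y)
    (hT : ¬ (x = 0 ∧ y = 0)) :
    ∃ i j k : ℕ, i < 5 ∧ j < 5 ∧ k < 5 ∧ ∀ (x'' y'' : ℚ) (h'' : E.toAffine.Nonsingular x'' y''),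
      Affine.Point.some x y h + i • T₂ + j • P₁ + k • P₂ = .some x'' y'' h'' → ¬ (x'' = 0 ∧ y'' = 0) →
      ∃ t : ℚ, t ≠ 0 ∧ x'' * y'' - 14 * x'' ^ 2 + 14 ^ 2 * y'' = t ^ 5 := by
  haveI i2 : Fact (Nat.Prime 2) := ⟨Nat.prime_two⟩
  haveI i7 : Fact (Nat.Prime 7) := ⟨by norm_num⟩
  haveI i13 : Fact (Nat.Prime 13) := ⟨by norm_num⟩
  have hf0 : x * y - 14 * x ^ 2 + 14 ^ 2 * y ≠ 0 := f_ne_zero h hT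
  set t₂ : ℤ := padicValRat 2 (x * y - 14 * x ^ 2 + 14 ^ 2 * y) with ht₂
  set t₇ : ℤ := padicValRat 7 (x * y - 14 * x ^ 2 + 14 ^ 2 * y) with ht₇
  set t₁₃ : ℤ := padicValRat 13 (x * y - 14 * x ^ 2 + 14 ^ 2 * y) with ht₁₃
  refine ⟨((t₂ + 3 * t₇ + 2 * t₁₃) % 5).toNat, ((2 * t₂ + t₇ + 3 * t₁₃) % 5).toNat,
    ((2 * t₂ + 2 * t₇ + 4 * t₁₃) % 5).toNat, by omega, by omega, by omega, ?_⟩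
  intro x'' y'' h'' e hT''
  have hf''0 : x'' * y'' - 14 * x'' ^ 2 + 14 ^ 2 * y'' ≠ 0 := f_ne_zero h'' hT''
  obtain ⟨u, t₀, hu0, ht₀0, hQ⟩ := exists_rel_translate h hT h'' hT'' e
  have hi : (5 : ℤ) ∣ (((t₂ + 3 * t₇ + 2 * t₁₃) % 5).toNat : ℤ) - (t₂ + 3 * t₇ + 2 * t₁₃) := by omega
  have hj : (5 : ℤ) ∣ (((2 * t₂ + t₇ + 3 * t₁₃) % 5).toNat : ℤ) - (2 * t₂ + t₇ + 3 * t₁₃) := by omega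
  have hk : (5 : ℤ) ∣ (((2 * t₂ + 2 * t₇ + 4 * t₁₃) % 5).toNat : ℤ) - (2 * t₂ + 2 * t₇ + 4 * t₁₃) := by
    omega
  obtain ⟨⟨a2, b2, c2⟩, ⟨a7, b7, c7⟩, ⟨a13, b13, c13⟩⟩ := vals'
  have h2 := five_dvd_of_rel_translate (p := 2) hf0 hf''0 hu0 ht₀0 hQ
  have h7 := five_dvd_of_rel_translate (p := 7) hf0 hf''0 hu0 ht₀0 hQ
  have h13 := five_dvd_of_rel_translate (p := 13) hf0 hf''0 hu0 ht₀0 hQ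
  rw [a2, b2, c2] at h2
  rw [a7, b7, c7] at h7
  rw [a13, b13, c13] at h13
  obtain ⟨d2, d7, d13⟩ := solve_mod_five hi hj hk h2 h7 h13
  have hall : ∀ p : ℕ, p.Prime → (5 : ℤ) ∣ padicValRat p (x'' * y'' - 14 * x'' ^ 2 + 14 ^ 2 * y'') := by
    intro p hp
    haveI : Fact p.Prime := ⟨hp⟩
    by_cases hp2 : p = 2
    · subst hp2; exact d2
    by_cases hp7 : p = 7
    · subst hp7; exact d7
    by_cases hp13 : p = 13
    · subst hp13; exact d13
    exact five_dvd_padicValRat_f h'' hT'' hp2 hp7 hp13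
  exact X1Eleven.exists_eq_pow_of_forall_dvd_padicValRat hf''0 (by decide) hall

end KubertTate1314Descent

end Literature.NumberTheory.EllipticCurves

end
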